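import Mathlib
import Summits.Ventures.PercRepro2.Defs
import Summits.Ventures.PercRepro2.Independence
import Summits.Ventures.PercRepro2.Graph
import Summits.Ventures.PercRepro2.Exploration
import Summits.Ventures.PercRepro2.Induced
import Summits.Ventures.PercRepro2.HubModel

/-!
# The a₃-hub model: five-mark connectivity in the class R₃ is read off the a₃-edges and the
inner pattern (blind cell PercRepro2, mine-2 g15; MINE2-A3FIRST.md §3 — typer-1's `HubModel`
with the roles of `a₃` and the roots exchanged)

Marks `o, a₁, a₂, a₃, b` are placed by an injective `μ : Mark → V` (`Hub.Mark`). The **class R₃**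
(`ClassR3`): every edge at `a₃` joins two marks. The **inner configuration** `innerConfig3` closes
every edge at `a₃` (`delConfig`), so the inner graph `G′ = G − a₃` is percolation on the same space.
The **model graph** `modelGraph3 ends μ ω` on the five marks has a pair containing `a₃` adjacent iff
some edge between them is open (`OpenAdj`), and a pair of the other four marks (`o, a₁, a₂, b`)
adjacent iff they are connected in `G′`.

* `conn_iff_modelReachable33` — **the structural lemma**: for `G ∈ R₃` and marks `u, v`, `u ↔ v` in
  `ω` iff `u` and `v` are reachable in the model graph. Proof by the closure lemma exactly as in
  `Hub.conn_iff_modelReachable3`: an edge of `G ∈ R₃` is either inner (no end at `a₃`) or an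
  `a₃`-edge between two marks; `a₃` is isolated in `G′` (`eq_of_conn_inner_a3`), so an inner
  connection between marks lifts to the model (`reachable_of_conn_inner33`).

The model graph depends on `ω` only through the four `a₃`-bundle states and the inner 4-mark
partition of `(o, a₁, a₂, b)` — the a₃-hub of MINE2-A3FIRST.md §3 (table hub3_W.txt, 66 nonzero
type vectors); the independence of the two groups and the Bernstein expansion are the next files.
-/

namespace Summit.Ventures.PercRepro2.Hub

/-- The special mark of the a₃-hub: `a₃` itself. -/
def Mark.IsA3 (m : Mark) : Prop := m = .a₃

/-- Being `a₃` is decidable. -/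
instance : DecidablePred Mark.IsA3 := fun m => by unfold Mark.IsA3; infer_instance

end Summit.Ventures.PercRepro2.Hub

namespace Summit.Ventures.PercRepro2.Hub3

open Hub

variable {V : Type*} {E : Type*}

/-- The inner configuration: every edge at `a₃` closed (`G′ = G − a₃`). -/
noncomputable def innerConfig3 (ends : E → Sym2 V) (μ : Mark → V) (ω : Config E) : Config E :=
  delConfig ends {μ .a₃} ω

/-- **Class R₃**: every edge at `a₃` joins two marks. -/
def ClassR3 (ends : E → Sym2 V) (μ : Mark → V) : Prop :=
  ∀ e, e ∈ touches ends {μ .a₃} → ∃ m m' : Mark, ends e = s(μ m, μ m')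

/-- The model adjacency read off `ω`: a pair containing `a₃` is adjacent iff some edge between
the two marks is open; a pair of the other marks is adjacent iff they are connected in `G′`. -/
def modelAdj3 (ends : E → Sym2 V) (μ : Mark → V) (ω : Config E) (u v : Mark) : Prop :=
  if u.IsA3 ∨ v.IsA3 then OpenAdj ends ω (μ u) (μ v)
  else Conn ends (innerConfig3 ends μ ω) (μ u) (μ v)

/-- The model graph on the five marks. -/
def modelGraph3 (ends : E → Sym2 V) (μ : Mark → V) (ω : Config E) : SimpleGraph Mark :=
  SimpleGraph.fromRel (modelAdj3 ends μ ω)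

section Basic

variable {ends : E → Sym2 V} {μ : Mark → V} {ω : Config E}

/-- The inner configuration lies below `ω`. -/
lemma innerConfig3_le : innerConfig3 ends μ ω ≤ ω := by
  intro e
  by_cases h : e ∈ touches ends {μ .a₃}
  · rw [innerConfig3, delConfig_apply_of_mem h]
    exact Bool.false_le _
  · rw [innerConfig3, delConfig_apply_of_notMem h]

/-- `a₃`'s vertex lies in the closed set of the inner configuration. -/
lemma a3_mem {m : Mark} (hm : m.IsA3) : μ m ∈ ({μ .a₃} : Set V) := by
  rw [hm]; simp

/-- An injective marking sends only `a₃` onto `a₃`'s vertex. -/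
lemma isA3_of_mem (hinj : Function.Injective μ) {m : Mark}
    (h : μ m ∈ ({μ .a₃} : Set V)) : m.IsA3 :=
  hinj (Set.mem_singleton_iff.1 h)

/-- `a₃` is isolated in the inner configuration. -/
lemma eq_of_conn_inner_a3 {m : Mark} (hm : m.IsA3) {x : V}
    (h : Conn ends (innerConfig3 ends μ ω) (μ m) x) : x = μ m := by
  have hx : x ∈ ({μ m} : Set V) := by
    refine mem_of_conn_of_closed (ends := ends) (ω := innerConfig3 ends μ ω) (S := {μ m}) ?_ rfl h
    intro y hy z hyz
    rw [Set.mem_singleton_iff] at hy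
    subst hy
    obtain ⟨_, e, he, hends⟩ := openGraph_adj.1 hyz
    have ht : e ∈ touches ends {μ .a₃} := ⟨μ m, a3_mem hm, z, hends⟩
    rw [innerConfig3, delConfig_apply_of_mem ht] at he
    exact absurd he Bool.false_ne_true
  exact Set.mem_singleton_iff.1 hx

/-- A model adjacency gives a connection in `ω`. -/
lemma conn_of_modelAdj3 {u v : Mark} (h : modelAdj3 ends μ ω u v) : Conn ends ω (μ u) (μ v) := by
  unfold modelAdj3 at h
  split_ifs at h with hr
  · exact conn_of_openAdj h
  · exact conn_mono innerConfig3_le h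

/-- A model edge gives a connection in `ω`. -/
lemma conn_of_modelGraph3_adj {u v : Mark} (h : (modelGraph3 ends μ ω).Adj u v) :
    Conn ends ω (μ u) (μ v) := by
  rw [modelGraph3, SimpleGraph.fromRel_adj] at h
  rcases h.2 with h' | h'
  · exact conn_of_modelAdj3 h'
  · exact conn_symm (conn_of_modelAdj3 h')

/-- **Inner connections between marks lift to the model**: if `u` reaches `m` in the model and
`m ↔ m′` in `G′`, then `u` reaches `m′`. -/
lemma reachable_of_conn_inner3 (hinj : Function.Injective μ) {u m m' : Mark}
    (hm : (modelGraph3 ends μ ω).Reachable u m)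
    (h : Conn ends (innerConfig3 ends μ ω) (μ m) (μ m')) :
    (modelGraph3 ends μ ω).Reachable u m' := by
  by_cases hmm : m = m'
  · subst hmm
    exact hm
  by_cases hr : m.IsA3
  · exact absurd (hinj (eq_of_conn_inner_a3 hr h)).symm hmm
  by_cases hr' : m'.IsA3
  · exact absurd (hinj (eq_of_conn_inner_a3 hr' (conn_symm h))) hmm
  have hadj : (modelGraph3 ends μ ω).Adj m m' := by
    rw [modelGraph3, SimpleGraph.fromRel_adj]
    refine ⟨hmm, Or.inl ?_⟩
    unfold modelAdj3
    rw [if_neg (not_or.2 ⟨hr, hr'⟩)]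
    exact h
  exact hm.trans hadj.reachable

/-- **Open `a₃`-edges lift to the model**: if `u` reaches `m` and an open edge joins the marks
`m`, `m′`, one of them `a₃`, then `u` reaches `m′`. -/
lemma reachable_of_openAdj3 {u m m' : Mark} (hm : (modelGraph3 ends μ ω).Reachable u m)
    (hr : m.IsA3 ∨ m'.IsA3) (h : OpenAdj ends ω (μ m) (μ m')) :
    (modelGraph3 ends μ ω).Reachable u m' := by
  by_cases hmm : m = m'
  · subst hmm
    exact hm
  have hadj : (modelGraph3 ends μ ω).Adj m m' := by
    rw [modelGraph3, SimpleGraph.fromRel_adj]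
    refine ⟨hmm, Or.inl ?_⟩
    unfold modelAdj3
    rw [if_pos hr]
    exact h
  exact hm.trans hadj.reachable

end Basic

section Structural

variable {ends : E → Sym2 V} {μ : Mark → V} {ω : Config E}

/-- Reachability in the model gives a connection in `ω`. -/
theorem conn_of_modelReachable3 {u v : Mark} (h : (modelGraph3 ends μ ω).Reachable u v) :
    Conn ends ω (μ u) (μ v) := by
  rw [SimpleGraph.reachable_iff_reflTransGen] at h
  induction h with
  | refl => exact conn_refl _ _ _
  | tail _ hadj ih => exact conn_trans ih (conn_of_modelGraph3_adj hadj)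

/-- **The structural lemma** (MINE2-A3FIRST.md §3): in the class R₃, two marks are connected in
`ω` iff they are reachable in the model graph read off the `a₃`-edges and the inner pattern. -/
theorem conn_iff_modelReachable3 (hinj : Function.Injective μ) (hR : ClassR3 ends μ) (u v : Mark) :
    Conn ends ω (μ u) (μ v) ↔ (modelGraph3 ends μ ω).Reachable u v := by
  refine ⟨fun h => ?_, conn_of_modelReachable3⟩
  -- the set of vertices reached from `u` through the model: a mark `m` reached in the model,
  -- then an inner connection
  have key : μ v ∈ {x | ∃ m : Mark, (modelGraph3 ends μ ω).Reachable u m ∧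
      Conn ends (innerConfig3 ends μ ω) (μ m) x} := by
    refine mem_of_conn_of_closed (ends := ends) (ω := ω) ?_
      ⟨u, SimpleGraph.Reachable.refl u, conn_refl _ _ _⟩ h
    rintro x ⟨m, hm, hmx⟩ y hxy
    obtain ⟨_, e, he, hends⟩ := openGraph_adj.1 hxy
    by_cases ht : e ∈ touches ends {μ .a₃}
    · -- an `a₃`-edge: both endpoints are marks, one of them `a₃`
      obtain ⟨m₁, m₂, hm12⟩ := hR e ht
      have hroot : m₁.IsA3 ∨ m₂.IsA3 := by
        obtain ⟨z, hz, w, hzw⟩ := ht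
        rw [hm12, Sym2.eq_iff] at hzw
        rcases hzw with ⟨h1, _⟩ | ⟨_, h2⟩
        · exact Or.inl (isA3_of_mem hinj (h1 ▸ hz))
        · exact Or.inr (isA3_of_mem hinj (h2 ▸ hz))
      rw [hends, Sym2.eq_iff] at hm12
      rcases hm12 with ⟨hx, hy⟩ | ⟨hx, hy⟩
      · subst hx
        subst hy
        have h1 := reachable_of_conn_inner3 hinj hm hmx
        exact ⟨m₂, reachable_of_openAdj3 h1 hroot ⟨e, he, hends⟩, conn_refl _ _ _⟩
      · subst hx
        subst hy
        have h1 := reachable_of_conn_inner3 hinj hm hmx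
        refine ⟨m₁, reachable_of_openAdj3 h1 hroot.symm ⟨e, he, ?_⟩, conn_refl _ _ _⟩
        rw [hends, Sym2.eq_swap]
    · -- an inner edge: it stays open in `G′`
      have he' : innerConfig3 ends μ ω e = true := by
        rw [innerConfig3, delConfig_apply_of_notMem ht]
        exact he
      exact ⟨m, hm, conn_trans hmx (conn_of_openAdj ⟨e, he', hends⟩)⟩
  obtain ⟨m, hm, hmv⟩ := key
  exact reachable_of_conn_inner3 hinj hm hmv

end Structural

end Summit.Ventures.PercRepro2.Hub3
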